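import Literature.MathematicalPhysics.QuantumLattice.GrassmannEffectiveActionTruncationDB
import Literature.Probability.LatticeModels.UrsellMultilinear
import HarnessLib

/-!
# The POLARISED GRADED cumulant bound, TELESCOPED: one slot carries the difference profile, the others the COMMON majorant
# (determinant-bounded covariances)

Topic `MathematicalPhysics/QuantumLattice`; the two-interaction twin of `GrassmannEffectiveActionGradedTruncationDB.sum_norm_kernel_cumulantOf_le_graded_of_gramBounded`
(one interaction, the leg constraint `r + 2(n−1) ≤ Σ_a 2δ_a` KEPT) and the graded refinement of the species expansion of
`GrassmannEffectiveActionLipschitzDB` (two interactions, flat).  The truncated expectations `𝓔ᵀ_C(X₀,…,X_{n−1})` are MULTILINEAR in the vertices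
(`Literature.Probability.LatticeModels.UrsellMultilinear`, Ruelle 1969 §4.4.2; Benfatto–Giuliani–Mastropietro 2006, (2.31)), so for two even
interactions `V`, `V′`
`𝓔ᵀ_C(V; n) − 𝓔ᵀ_C(V′; n) = Σ_a 𝓔ᵀ_C(V′,…,V′, V − V′, V,…,V)` (slot `a` carries the difference, the slots before it `V′`, the slots after it `V`), and the
tree-expansion bound `GrassmannTruncatedBoundDB.sum_norm_kernel_ursellOf_kernelVertex_le_of_gramBounded` — stated for ARBITRARY per-copy kernels —
bounds every term with the difference profile `ν` in slot `a` and a COMMON majorant `μ` of the profiles of `V`, `V′` in the others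
(Benfatto–Giuliani–Mastropietro 2006, (2.13)–(2.14), (2.77)–(2.80); Gawȩdzki–Kupiainen 1985, §3):

* `ursellOf_convMoment_update_add` — the truncated expectation of a family of even vertices is additive in each vertex (replica level);
* (private) `convMoment_update_*`, `kernelVertex_eq_add_of_eq_add`, `replicaKer_eq_add_sub` — moments / kernel vertices / replica kernels are additive in one slot;
* **`sum_norm_kernel_cumulantOf_sub_le_graded_of_gramBounded`** — for `V = Σ_{m' ∈ degs} Σ_Y K ψ`, `V′ = Σ Σ K′ ψ` with pinned `L¹` norms of
  `K(m',·)`, `K′(m',·)` at most `μ(m')` and of `K(m',·) − K′(m',·)` at most `ν(m')`, one output label pinned,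
  `Σ_{W : W_i = w} ‖kernel_r (𝓔ᵀ_C(V; n) − 𝓔ᵀ_C(V′; n))(W)‖ ≤
     n!·ρ^{-r}κ^{-2(n−1)}α^{n−1}eⁿ · Σ_{δ ∈ degs^n : r + 2(n−1) ≤ Σ 2δ_a} Σ_a g_ν(δ_a)·Π_{b ≠ a} g_μ(δ_b)`,
  `g_ν(d) = (e²(κ+ρ))^{2d}ν(d)`, `g_μ(d) = (e²(κ+ρ))^{2d}μ(d)` — off the leg constraint every term vanishes (`GrassmannVacuumBoundDB`).

The consumer is the graded Lipschitz step `GrassmannEffectiveActionGradedLipschitzDB`; its inner sum is the mixed graded sum of a Lipschitz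
(two-volume / two-cutoff difference) multiscale bookkeeping.  Everything is proved; no definition, no named fact.

## Sources

G. Benfatto, A. Giuliani, V. Mastropietro, Ann. Henri Poincaré 7 (2006) 809–898, (2.13)–(2.14), (2.31), (2.77)–(2.80)
[`BenfattoGiulianiMastropietro2006`]; K. Gawȩdzki, A. Kupiainen, Comm. Math. Phys. 102 (1985) 1–30, §3 [`GawedzkiKupiainen1985GrossNeveu`];
D. Ruelle, *Statistical Mechanics: Rigorous Results* (1969), §4.4.2 [`Ruelle1969`].
-/

noncomputable section

namespace Literature.MathematicalPhysics.QuantumLattice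

open GrassmannAlgebra Finset Literature.Probability.LatticeModels
open scoped InnerProductSpace Nat

universe u

/-! ### The truncated expectation is additive in each vertex -/

section SlotAdditive

variable (R : Type*) [CommRing R] [Algebra ℚ R] {Γ : Type*} [Fintype Γ] [DecidableEq Γ] {ι : Type*} [Fintype ι] [DecidableEq ι]
variable (C : Matrix Γ Γ R)

omit [DecidableEq Γ] [Fintype ι] in
/-- The convolution moments of a family updated in the slot `j` agree with the original ones on the sets not containing `j`. [folklore] -/
private theorem convMoment_update_eq_of_not_mem (M : ι → evenPart R Γ) (j : ι) (x : evenPart R Γ) {P : Finset ι} (hj : j ∉ P) :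
    convMoment R C (Function.update M j x) P = convMoment R C M P := by
  rw [convMoment, convMoment, prod_congr rfl fun v hv => Function.update_of_ne (ne_of_mem_of_not_mem hv hj) x M]

omit [DecidableEq Γ] [Fintype ι] in
/-- The convolution moments are additive in the slot `j` on the sets containing `j`. [folklore] -/
private theorem convMoment_update_add_of_mem (M : ι → evenPart R Γ) (j : ι) (x y : evenPart R Γ) {P : Finset ι} (hj : j ∈ P) :
    convMoment R C (Function.update M j (x + y)) P =
      convMoment R C (Function.update M j x) P + convMoment R C (Function.update M j y) P := by
  rw [convMoment, convMoment, convMoment, prod_update_of_mem hj, prod_update_of_mem hj, prod_update_of_mem hj, add_mul, map_add]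

omit [DecidableEq Γ] in
/-- **The truncated expectation of a family of even vertices is additive in each vertex** (multilinearity of `𝓔ᵀ`; Ruelle 1969 §4.4.2,
BGM 2006 (2.31)): `𝓔ᵀ(…, x + y, …) = 𝓔ᵀ(…, x, …) + 𝓔ᵀ(…, y, …)`. [cite: Ruelle1969, §4.4.2] -/
theorem ursellOf_convMoment_update_add (M : ι → evenPart R Γ) (j : ι) (x y : evenPart R Γ) :
    ursellOf (convMoment R C (Function.update M j (x + y))) univ =
      ursellOf (convMoment R C (Function.update M j x)) univ + ursellOf (convMoment R C (Function.update M j y)) univ :=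
  ursellOf_eq_add_of_linear _ _ _ j
    (fun P hP => by rw [convMoment_update_eq_of_not_mem R C M j x hP, convMoment_update_eq_of_not_mem R C M j (x + y) hP])
    (fun P hP => by rw [convMoment_update_eq_of_not_mem R C M j y hP, convMoment_update_eq_of_not_mem R C M j (x + y) hP])
    (fun P hP => convMoment_update_add_of_mem R C M j x y hP) (mem_univ j)

end SlotAdditive

/-! ### Kernel vertices are additive in the kernel -/

section KernelAdditive

variable (R : Type*) [CommRing R] {Γ : Type*} [Fintype Γ] [DecidableEq Γ] {n : ℕ}

/-- A kernel vertex whose kernel at the slot `v` is a sum is the sum of the kernel vertices. [folklore] -/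
private theorem kernelVertex_eq_add_of_eq_add {deg : Fin n → ℕ} (hm : ∀ v, Even (deg v)) (K K₁ K₂ : ∀ v : Fin n, (Fin (deg v) → Γ) → R)
    (v : Fin n) (h : ∀ Y, K v Y = K₁ v Y + K₂ v Y) :
    kernelVertex R hm K v = kernelVertex R hm K₁ v + kernelVertex R hm K₂ v := by
  simp only [kernelVertex, h, add_smul, sum_add_distrib]

/-- A kernel vertex depends on its own kernel only. [folklore] -/
private theorem kernelVertex_congr_slot {deg : Fin n → ℕ} (hm : ∀ v, Even (deg v)) (K K' : ∀ v : Fin n, (Fin (deg v) → Γ) → R)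
    (v : Fin n) (h : K v = K' v) : kernelVertex R hm K v = kernelVertex R hm K' v := by
  simp only [kernelVertex, h]

omit [Fintype Γ] [DecidableEq Γ] in
/-- Replica kernels are additive in the kernel: the replica of `K` is the replica of `K′` plus the replica of `K − K′`. [folklore] -/
private theorem replicaKer_eq_add_sub {m : ℕ} (K K' : (Fin m → Γ) → R) (a : Fin n) (Y' : Fin m → Fin n × Γ) :
    replicaKer R K a Y' = replicaKer R K' a Y' + replicaKer R (fun Y => K Y - K' Y) a Y' := by
  simp only [replicaKer]
  split_ifs <;> ring

end KernelAdditive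

/-! ### The polarised graded cumulant bound -/

section Polarised

variable {𝕜 : Type*} [RCLike 𝕜] {Γ : Type u} [Fintype Γ] [DecidableEq Γ] {n : ℕ} (C : Matrix Γ Γ 𝕜)

omit [Fintype Γ] [DecidableEq Γ] in
/-- Kernels of a difference. [folklore] -/
private theorem kernel_sub_eq (A B : GrassmannAlgebra 𝕜 Γ) (m : ℕ) (X : Fin m → Γ) :
    kernel 𝕜 (A - B) m X = kernel 𝕜 A m X - kernel 𝕜 B m X := by
  rw [sub_eq_add_neg, kernel_add, ← neg_one_smul 𝕜 B, kernel_smul, neg_one_mul, ← sub_eq_add_neg]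

/-- **The POLARISED GRADED cumulant bound** (BGM 2006 (2.13)–(2.14) with (2.77)–(2.80), telescoped form): even elements
`V = Σ_{m' ∈ degs} Σ_Y K(m',Y) ψ(Y)`, `V′ = Σ Σ K′ ψ` with pinned `L¹` norms of `K(m',·)`, `K′(m',·)` at most a COMMON majorant `μ(m')` and of
the difference `K(m',·) − K′(m',·)` at most `ν(m')`; a charged covariance replica-Gram-bounded with constant `κ > 0`, one-copy row and column sums
`≤ α`, an output weight `ρ > 0`; one output label pinned and the others summed:
`Σ_{W : W_i = w} ‖kernel_r (𝓔ᵀ_C(V; n) − 𝓔ᵀ_C(V′; n))(W)‖ ≤ n!·ρ^{-r}κ^{-2(n−1)}α^{n−1}eⁿ · Σ_{δ : r + 2(n−1) ≤ Σ 2δ_a} Σ_a g_ν(δ_a)·Π_{b ≠ a} g_μ(δ_b)`,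
`g_ν(d) = (e²(κ+ρ))^{2d}ν(d)`, `g_μ(d) = (e²(κ+ρ))^{2d}μ(d)` — by the telescoping `𝓔ᵀ(V;n) − 𝓔ᵀ(V′;n) = Σ_a 𝓔ᵀ(V′,…,V′, V−V′, V,…,V)` at the replica
level and the tree-expansion bound with per-copy profiles; the leg constraint is KEPT (off it every term vanishes).
[cite: BenfattoGiulianiMastropietro2006, (2.13)-(2.14) and (2.77)-(2.80)] -/
theorem sum_norm_kernel_cumulantOf_sub_le_graded_of_gramBounded {κ : ℝ} (hκ : 0 < κ) (hGB : IsGramBoundedR C κ)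
    (degs : Finset ℕ) (K K' : (m' : ℕ) → (Fin (2 * m') → Γ) → 𝕜) (μ ν : ℕ → ℝ) (hμ0 : ∀ m', 0 ≤ μ m') (hν0 : ∀ m', 0 ≤ ν m')
    (hK : ∀ m' (j : Fin (2 * m')) (w : Γ), ∑ Y ∈ univ.filter (fun Y : Fin (2 * m') → Γ => Y j = w), ‖K m' Y‖ ≤ μ m')
    (hK' : ∀ m' (j : Fin (2 * m')) (w : Γ), ∑ Y ∈ univ.filter (fun Y : Fin (2 * m') → Γ => Y j = w), ‖K' m' Y‖ ≤ μ m')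
    (hD : ∀ m' (j : Fin (2 * m')) (w : Γ), ∑ Y ∈ univ.filter (fun Y : Fin (2 * m') → Γ => Y j = w), ‖K m' Y - K' m' Y‖ ≤ ν m')
    {α : ℝ} (hα : 0 < α) (hrow : ∀ X, ∑ Y, ‖C X Y‖ ≤ α) (hcol : ∀ Y, ∑ X, ‖C X Y‖ ≤ α) {ρ : ℝ} (hρ : 0 < ρ)
    (hn : 0 < n) {r : ℕ} (i : Fin r) (w : Γ) :
    ∑ W ∈ univ.filter (fun W : Fin r → Γ => W i = w),
        ‖kernel 𝕜 ((cumulantOf (fun k => evenGaussConv 𝕜 C (vertexOf 𝕜 degs K ^ k)) n : evenPart 𝕜 Γ) : GrassmannAlgebra 𝕜 Γ) r W -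
          kernel 𝕜 ((cumulantOf (fun k => evenGaussConv 𝕜 C (vertexOf 𝕜 degs K' ^ k)) n : evenPart 𝕜 Γ) : GrassmannAlgebra 𝕜 Γ) r W‖ ≤
      (n ! : ℝ) * (ρ⁻¹ ^ r * κ⁻¹ ^ (2 * (n - 1)) * (α ^ (n - 1) * Real.exp n)) *
        ∑ δ ∈ (Fintype.piFinset fun _ : Fin n => degs) with r + 2 * (n - 1) ≤ ∑ a, 2 * δ a,
          ∑ a, (Real.exp 2 * (κ + ρ)) ^ (2 * δ a) * ν (δ a) * ∏ b ∈ univ.erase a, (Real.exp 2 * (κ + ρ)) ^ (2 * δ b) * μ (δ b) := by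
  set C' : Matrix (Fin n × Γ) (Fin n × Γ) 𝕜 := C.submatrix Prod.snd Prod.snd with hC'
  have huniv : (univ : Finset (Fin n)).Nonempty := ⟨⟨0, hn⟩, mem_univ _⟩
  have hGB' : IsGramBounded C' κ := by rw [hC']; exact (hGB.submatrix Prod.snd).isGramBounded
  -- three species of kernels: `0 ↦ K′`, `1 ↦ K − K′` (the difference), `2 ↦ K`; profiles `ν` for species `1`, `μ` otherwise
  set D : (m' : ℕ) → (Fin (2 * m') → Γ) → 𝕜 := fun m' Y => K m' Y - K' m' Y with hDdef
  set Ksp : Fin 3 → (m' : ℕ) → (Fin (2 * m') → Γ) → 𝕜 := fun s => if s = 1 then D else if s = 0 then K' else K with hKsp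
  set Nsp : Fin 3 → ℕ → ℝ := fun s => if s = 1 then ν else μ with hNsp
  have hNsp0 : ∀ s m', 0 ≤ Nsp s m' := by
    intro s m'; simp only [hNsp]; split_ifs; exacts [hν0 m', hμ0 m']
  have hNspB : ∀ s m' (j : Fin (2 * m')) (w : Γ), ∑ Y ∈ univ.filter (fun Y : Fin (2 * m') → Γ => Y j = w), ‖Ksp s m' Y‖ ≤ Nsp s m' := by
    intro s m' j w
    simp only [hKsp, hNsp]
    split_ifs with h1 h0
    · exact hD m' j w
    · exact hK' m' j w
    · exact hK m' j w
  -- the replica families indexed by species-and-degree assignments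
  set U : (Fin n → Fin 3 × ℕ) → evenPart 𝕜 (Fin n × Γ) := fun η => ursellOf (convMoment 𝕜 C'
    (kernelVertex 𝕜 (deg := fun b : Fin n => 2 * (η b).2) (fun b => even_two_mul (η b).2)
      fun b => replicaKer 𝕜 (Ksp (η b).1 (η b).2) b)) univ with hU
  -- (1) the bound per assignment and pinned copy, on the leg constraint; vanishing off it
  set g : Fin 3 × ℕ → ℝ := fun sm => (Real.exp 2 * (κ + ρ)) ^ (2 * sm.2) * Nsp sm.1 sm.2 with hg
  have hg0 : ∀ sm, 0 ≤ g sm := fun sm => mul_nonneg (by positivity) (hNsp0 _ _)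
  set c : ℝ := ρ⁻¹ ^ r * κ⁻¹ ^ (2 * (n - 1)) * (((n - 1)! : ℝ) * α ^ (n - 1) * Real.exp n) with hc
  have hc0 : 0 ≤ c := by positivity
  have hKs : ∀ (η : Fin n → Fin 3 × ℕ) (v : Fin n) (Yv : Fin (2 * (η v).2) → Fin n × Γ),
      replicaKer 𝕜 (Ksp (η v).1 (η v).2) v Yv ≠ 0 → ∀ j, (Yv j).1 = v :=
    fun η v Yv h j => replicaKer_support 𝕜 (Ksp (η v).1 (η v).2) v Yv h j
  have hηle : ∀ (η : Fin n → Fin 3 × ℕ), r + 2 * (n - 1) ≤ ∑ a, 2 * (η a).2 → ∀ b : Fin n,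
      ∑ W' ∈ univ.filter (fun W' : Fin r → Fin n × Γ => W' i = (b, w)), ‖kernel 𝕜 (U η : GrassmannAlgebra 𝕜 (Fin n × Γ)) r W'‖ ≤
        c * ∏ a, g (η a) := by
    intro η hle b
    set δ : Fin n → ℕ := fun a => (η a).2 with hδ
    have hcore := sum_norm_kernel_ursellOf_kernelVertex_le_of_gramBounded C' (Prod.fst : Fin n × Γ → Fin n)
      (fun b => replicaKer 𝕜 (Ksp (η b).1 (η b).2) b) hκ.le hGB'
      (fun b => even_two_mul (η b).2) (hKs η) (fun u => Nsp (η u).1 (η u).2) (fun u => hNsp0 _ _)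
      (fun u j a' => sum_filter_norm_replicaKer_le (Ksp (η u).1 (η u).2) u (hNspB (η u).1 (η u).2) j a') hα.le
      (fun ℓ X' => sum_norm_typeRestrict_submatrix_le C hα.le hrow ℓ X') (fun ℓ Y' => sum_norm_typeRestrict_submatrix_le' C hα.le hcol ℓ Y')
      (lam := (α * ((∑ a, (2 * δ a : ℝ)) + n))⁻¹) (by positivity) i (b, w)
    refine hcore.trans ?_
    have hsumδ : (∑ v, 2 * (η v).2) = ∑ a, 2 * δ a := rfl
    have hA := choose_mul_pow_le (N := ∑ a, 2 * δ a) (r := r) (m := 2 * (n - 1)) hle hκ hρ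
    have hTr := treeFactor_choice_le hn δ hα
    have hNprod : 0 ≤ ∏ u, Nsp (η u).1 (η u).2 := prod_nonneg fun u _ => hNsp0 _ _
    have hTnonneg : 0 ≤ ((α * ((∑ a, (2 * δ a : ℝ)) + n))⁻¹)⁻¹ ^ (n - 1) *
        ∏ ℓ : Sym2 (Fin n), (1 + (α * ((∑ a, (2 * δ a : ℝ)) + n))⁻¹ * (α * (pairDeg (fun a => 2 * δ a) ℓ : ℝ))) := by
      have hs : 0 ≤ ∑ a, (2 * δ a : ℝ) := sum_nonneg fun a _ => by positivity
      exact mul_nonneg (by positivity) (prod_nonneg fun ℓ _ => by positivity)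
    have hpd : (pairDeg (fun b : Fin n => 2 * (η b).2)) = pairDeg (fun a => 2 * δ a) := rfl
    rw [hsumδ, hpd]
    calc ((((r.factorial : ℝ))⁻¹ * ((∑ a, 2 * δ a).descFactorial r : ℝ)) * κ ^ ((∑ a, 2 * δ a) - (r + 2 * (n - 1))) *
            ∏ u, Nsp (η u).1 (η u).2) *
          (((α * ((∑ a, (2 * δ a : ℝ)) + n))⁻¹)⁻¹ ^ (n - 1) *
            ∏ ℓ : Sym2 (Fin n), (1 + (α * ((∑ a, (2 * δ a : ℝ)) + n))⁻¹ * (α * (pairDeg (fun a => 2 * δ a) ℓ : ℝ))))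
        ≤ ((ρ⁻¹ ^ r * κ⁻¹ ^ (2 * (n - 1)) * (κ + ρ) ^ (∑ a, 2 * δ a)) * ∏ u, Nsp (η u).1 (η u).2) *
            (((n - 1).factorial : ℝ) * α ^ (n - 1) * Real.exp (2 * (∑ a, (2 * δ a : ℝ)) + n)) :=
          mul_le_mul (mul_le_mul_of_nonneg_right hA hNprod) hTr hTnonneg (by positivity)
      _ = c * ∏ a, g (η a) := by
          have hexp : Real.exp (2 * (∑ a, (2 * δ a : ℝ)) + n) = Real.exp n * ∏ a, Real.exp 2 ^ (2 * δ a) := by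
            rw [Real.exp_add, mul_comm, mul_sum, Real.exp_sum]
            congr 1
            refine prod_congr rfl fun a _ => ?_
            rw [← Real.exp_nat_mul]
            congr 1
            push_cast
            ring
          rw [hexp, ← prod_pow_eq_pow_sum, hc]
          simp only [hg, hδ, mul_pow, prod_mul_distrib]
          ring
  have hη0 : ∀ (η : Fin n → Fin 3 × ℕ), ¬ r + 2 * (n - 1) ≤ ∑ a, 2 * (η a).2 → ∀ W' : Fin r → Fin n × Γ,
      kernel 𝕜 (U η : GrassmannAlgebra 𝕜 (Fin n × Γ)) r W' = 0 := by
    intro η hlt W'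
    rw [hU]
    dsimp only
    exact kernel_ursellOf_kernelVertex_eq_zero_of_lt_of_gramBounded C' (Prod.fst : Fin n × Γ → Fin n)
      (fun b => replicaKer 𝕜 (Ksp (η b).1 (η b).2) b) hκ.le hGB' (fun b => even_two_mul (η b).2) (hKs η) ⟨0, hn⟩ (not_le.1 hlt) W'
  -- (2) the one-species families collapse to the cumulants of `V` and `V′`
  have hcumSp : ∀ s : Fin 3, ((cumulantOf (fun k => evenGaussConv 𝕜 C (vertexOf 𝕜 degs (Ksp s) ^ k)) n : evenPart 𝕜 Γ) :
      GrassmannAlgebra 𝕜 Γ) = ∑ δ ∈ Fintype.piFinset (fun _ : Fin n => degs),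
        collapse 𝕜 (Prod.snd : Fin n × Γ → Γ) (U (fun a => (s, δ a)) : GrassmannAlgebra 𝕜 (Fin n × Γ)) := by
    intro s
    have h1 := collapseEven_ursellOf_convMoment_eq_cumulantOf 𝕜 (Prod.snd : Fin n × Γ → Γ) C (replicaVertex 𝕜 degs (Ksp s))
      (vertexOf 𝕜 degs (Ksp s)) (collapseEven_replicaVertex 𝕜 degs (Ksp s)) huniv
    rw [card_univ, Fintype.card_fin] at h1
    rw [← h1, coe_collapseEven]
    have h2 : ursellOf (convMoment 𝕜 C' (replicaVertex 𝕜 degs (Ksp s))) univ =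
        ∑ δ ∈ Fintype.piFinset (fun _ : Fin n => degs), U (fun a => (s, δ a)) :=
      ursellOf_convMoment_eq_sum_piFinset 𝕜 C' (Prod.fst : Fin n × Γ → Fin n) (fun _ : Fin n => degs)
        (fun a m' => kernelVertex 𝕜 (deg := fun _ : Fin n => 2 * m') (fun _ => even_two_mul m') (fun b => replicaKer 𝕜 (Ksp s m') b) a)
        (fun a m' => coe_kernelVertex_replicaKer_mem 𝕜 m' (Ksp s m') a) ⟨0, hn⟩
    rw [← hC', h2, AddSubmonoidClass.coe_finsetSum, map_sum]
  have hKsp2 : Ksp 2 = K := by rw [hKsp]; dsimp only; rw [if_neg (by decide), if_neg (by decide)]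
  have hKsp0 : Ksp 0 = K' := by rw [hKsp]; dsimp only; rw [if_neg (by decide), if_pos rfl]
  have hKsp1 : Ksp 1 = D := by rw [hKsp]; dsimp only; rw [if_pos rfl]
  -- (3) TELESCOPING at fixed degrees: the species maps `fam j` (`X′` below `j`, `X` from `j` on) and `mix a` (`X′` below `a`, the difference at
  -- `a`, `X` above `a`)
  set fam : ℕ → Fin n → Fin 3 := fun j b => if (b : ℕ) < j then 0 else 2 with hfam
  set mix : Fin n → Fin n → Fin 3 := fun a b => if b = a then 1 else if b < a then 0 else 2 with hmix
  have htel : ∀ δ : Fin n → ℕ, U (fun b => ((2 : Fin 3), δ b)) - U (fun b => ((0 : Fin 3), δ b)) = ∑ a, U (fun b => (mix a b, δ b)) := by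
    intro δ
    -- the vertex families at fixed degrees, as a function of the species map
    set Mv : (Fin n → Fin 3) → Fin n → evenPart 𝕜 (Fin n × Γ) := fun s =>
      kernelVertex 𝕜 (deg := fun b : Fin n => 2 * δ b) (fun b => even_two_mul (δ b)) fun b => replicaKer 𝕜 (Ksp (s b) (δ b)) b with hMv
    have hUs : ∀ s : Fin n → Fin 3, U (fun b => (s b, δ b)) = ursellOf (convMoment 𝕜 C' (Mv s)) univ := fun s => rfl
    have hfam0 : (fun b => ((2 : Fin 3), δ b)) = fun b => (fam 0 b, δ b) := by
      funext b; rw [hfam]; dsimp only; rw [if_neg (Nat.not_lt_zero _)]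
    have hfamn : (fun b => ((0 : Fin 3), δ b)) = fun b => (fam n b, δ b) := by
      funext b; rw [hfam]; dsimp only; rw [if_pos b.2]
    rw [hfam0, hfamn, hUs, hUs]
    -- one telescoping step: at slot `a`, species `2 = 0 + 1` (`K = K′ + (K − K′)`)
    have hstep : ∀ a : Fin n, ursellOf (convMoment 𝕜 C' (Mv (fam a))) univ - ursellOf (convMoment 𝕜 C' (Mv (fam (a + 1)))) univ =
        ursellOf (convMoment 𝕜 C' (Mv (mix a))) univ := by
      intro a
      have hoff : ∀ (s : Fin n → Fin 3), (∀ b, b ≠ a → s b = mix a b) → Mv s = Function.update (Mv (mix a)) a (Mv s a) := by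
        intro s hs
        funext b
        by_cases hb : b = a
        · subst hb; rw [Function.update_self]
        · rw [Function.update_of_ne hb, hMv]
          exact kernelVertex_congr_slot 𝕜 (fun b => even_two_mul (δ b)) _ _ b (by simp only [hs b hb])
      have hfa : ∀ b, b ≠ a → fam a b = mix a b := by
        intro b hb
        rw [hfam, hmix]; dsimp only
        rw [if_neg hb]
        by_cases hlt : b < a
        · rw [if_pos (Fin.lt_def.1 hlt), if_pos hlt]
        · rw [if_neg (fun h => hlt (Fin.lt_def.2 h)), if_neg hlt]
      have hfa1 : ∀ b, b ≠ a → fam (a + 1) b = mix a b := by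
        intro b hb
        rw [hfam, hmix]; dsimp only
        rw [if_neg hb]
        have hne : (b : ℕ) ≠ a := fun h => hb (Fin.ext h)
        by_cases hlt : b < a
        · rw [if_pos (by have := Fin.lt_def.1 hlt; omega), if_pos hlt]
        · rw [if_neg (by have : ¬ (b : ℕ) < a := fun h => hlt (Fin.lt_def.2 h); omega), if_neg hlt]
      -- the three vertices at slot `a`
      have hva : Mv (fam a) a = Mv (fam (a + 1)) a + Mv (mix a) a := by
        rw [hMv]
        refine kernelVertex_eq_add_of_eq_add 𝕜 (fun b => even_two_mul (δ b)) _ _ _ a fun Y => ?_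
        have h2 : fam a a = 2 := by simp [hfam]
        have h0 : fam (a + 1) a = 0 := by simp [hfam]
        have h1 : mix a a = 1 := by simp [hmix]
        simp only [h2, h0, h1, hKsp2, hKsp0, hKsp1, hDdef]
        exact replicaKer_eq_add_sub 𝕜 (K (δ a)) (K' (δ a)) a Y
      rw [hoff (fam a) hfa, hoff (fam (a + 1)) hfa1, hva, ursellOf_convMoment_update_add, add_sub_cancel_left,
        ← hoff (mix a) fun b _ => rfl]
    -- sum the steps
    have hsum := Finset.sum_range_sub' (fun j => ursellOf (convMoment 𝕜 C' (Mv (fam j))) univ) n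
    rw [← hsum, ← Fin.sum_univ_eq_sum_range]
    exact sum_congr rfl fun a _ => hstep a
  -- (4) the difference of the cumulants as the sum over the odd slot and the degrees of the mixed families
  have hdiff : ∀ W : Fin r → Γ,
      kernel 𝕜 ((cumulantOf (fun k => evenGaussConv 𝕜 C (vertexOf 𝕜 degs K ^ k)) n : evenPart 𝕜 Γ) : GrassmannAlgebra 𝕜 Γ) r W -
        kernel 𝕜 ((cumulantOf (fun k => evenGaussConv 𝕜 C (vertexOf 𝕜 degs K' ^ k)) n : evenPart 𝕜 Γ) : GrassmannAlgebra 𝕜 Γ) r W =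
      ∑ a, ∑ δ ∈ Fintype.piFinset (fun _ : Fin n => degs),
        kernel 𝕜 (collapse 𝕜 (Prod.snd : Fin n × Γ → Γ) (U (fun b => (mix a b, δ b)) : GrassmannAlgebra 𝕜 (Fin n × Γ))) r W := by
    intro W
    have hK2 := hcumSp 2
    have hK0 := hcumSp 0
    rw [hKsp2] at hK2
    rw [hKsp0] at hK0
    rw [hK2, hK0, ← kernel_sub_eq, ← sum_sub_distrib, kernel_sum]
    conv_rhs => rw [sum_comm]
    refine sum_congr rfl fun δ _ => ?_
    rw [← map_sub, ← AddSubgroupClass.coe_sub, htel δ, AddSubmonoidClass.coe_finsetSum, map_sum, kernel_sum]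
  -- (5) the weights: the odd slot carries `ν`, the others `μ`
  have hgmix : ∀ (a : Fin n) (δ : Fin n → ℕ), ∏ b, g (mix a b, δ b) =
      (Real.exp 2 * (κ + ρ)) ^ (2 * δ a) * ν (δ a) * ∏ b ∈ univ.erase a, (Real.exp 2 * (κ + ρ)) ^ (2 * δ b) * μ (δ b) := by
    intro a δ
    rw [← mul_prod_erase univ (fun b => g (mix a b, δ b)) (mem_univ a)]
    have ha : mix a a = 1 := by rw [hmix]; dsimp only; rw [if_pos rfl]
    congr 1
    · rw [hg, hNsp]; dsimp only; rw [ha, if_pos rfl]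
    · refine prod_congr rfl fun b hb => ?_
      have hb' : mix a b ≠ 1 := by
        rw [hmix]; dsimp only; rw [if_neg (ne_of_mem_erase hb)]; split_ifs <;> decide
      rw [hg, hNsp]; dsimp only; rw [if_neg hb']
  -- (6) assemble
  set Δs : Finset (Fin n → ℕ) := (Fintype.piFinset fun _ : Fin n => degs) with hΔs
  calc ∑ W ∈ univ.filter (fun W : Fin r → Γ => W i = w),
        ‖kernel 𝕜 ((cumulantOf (fun k => evenGaussConv 𝕜 C (vertexOf 𝕜 degs K ^ k)) n : evenPart 𝕜 Γ) : GrassmannAlgebra 𝕜 Γ) r W -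
          kernel 𝕜 ((cumulantOf (fun k => evenGaussConv 𝕜 C (vertexOf 𝕜 degs K' ^ k)) n : evenPart 𝕜 Γ) : GrassmannAlgebra 𝕜 Γ) r W‖
      = ∑ W ∈ univ.filter (fun W : Fin r → Γ => W i = w), ‖∑ a, ∑ δ ∈ Δs,
          kernel 𝕜 (collapse 𝕜 (Prod.snd : Fin n × Γ → Γ) (U (fun b => (mix a b, δ b)) : GrassmannAlgebra 𝕜 (Fin n × Γ))) r W‖ :=
        sum_congr rfl fun W _ => by rw [hdiff W]
    _ ≤ ∑ W ∈ univ.filter (fun W : Fin r → Γ => W i = w), ∑ a, ∑ δ ∈ Δs,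
          ‖kernel 𝕜 (collapse 𝕜 (Prod.snd : Fin n × Γ → Γ) (U (fun b => (mix a b, δ b)) : GrassmannAlgebra 𝕜 (Fin n × Γ))) r W‖ :=
        sum_le_sum fun W _ => (norm_sum_le _ _).trans (sum_le_sum fun a _ => norm_sum_le _ _)
    _ = ∑ a, ∑ δ ∈ Δs, ∑ W ∈ univ.filter (fun W : Fin r → Γ => W i = w),
          ‖kernel 𝕜 (collapse 𝕜 (Prod.snd : Fin n × Γ → Γ) (U (fun b => (mix a b, δ b)) : GrassmannAlgebra 𝕜 (Fin n × Γ))) r W‖ := by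
        rw [sum_comm]; exact sum_congr rfl fun a _ => sum_comm
    _ ≤ ∑ a, ∑ δ ∈ Δs, if r + 2 * (n - 1) ≤ ∑ b, 2 * δ b then (n : ℝ) * (c * ∏ b, g (mix a b, δ b)) else 0 := by
        refine sum_le_sum fun a _ => sum_le_sum fun δ _ => ?_
        split_ifs with hle
        · calc _ ≤ ∑ b : Fin n, ∑ W' ∈ univ.filter (fun W' : Fin r → Fin n × Γ => W' i = (b, w)),
                ‖kernel 𝕜 (U (fun b => (mix a b, δ b)) : GrassmannAlgebra 𝕜 (Fin n × Γ)) r W'‖ := sum_filter_norm_kernel_collapse_le _ i w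
            _ ≤ ∑ _b : Fin n, c * ∏ b, g (mix a b, δ b) := sum_le_sum fun b _ => hηle (fun b => (mix a b, δ b)) hle b
            _ = (n : ℝ) * (c * ∏ b, g (mix a b, δ b)) := by rw [sum_const, card_univ, Fintype.card_fin, nsmul_eq_mul]
        · refine le_of_eq (sum_eq_zero fun W _ => ?_)
          rw [kernel_collapse, sum_eq_zero fun W' _ => hη0 (fun b => (mix a b, δ b)) hle W', norm_zero]
    _ = ∑ a, ∑ δ ∈ Δs with r + 2 * (n - 1) ≤ ∑ b, 2 * δ b, (n : ℝ) * (c * ∏ b, g (mix a b, δ b)) :=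
        sum_congr rfl fun a _ => (sum_filter _ _).symm
    _ = (n : ℝ) * c * ∑ δ ∈ Δs with r + 2 * (n - 1) ≤ ∑ b, 2 * δ b,
          ∑ a, (Real.exp 2 * (κ + ρ)) ^ (2 * δ a) * ν (δ a) * ∏ b ∈ univ.erase a, (Real.exp 2 * (κ + ρ)) ^ (2 * δ b) * μ (δ b) := by
        rw [sum_comm, mul_sum]
        refine sum_congr rfl fun δ _ => ?_
        rw [mul_sum]
        exact sum_congr rfl fun a _ => by rw [hgmix a δ]; ring
    _ = _ := by
        rw [hc, ← Nat.mul_factorial_pred (Nat.pos_iff_ne_zero.1 hn), Nat.cast_mul]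
        ring

end Polarised

end Literature.MathematicalPhysics.QuantumLattice

end
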